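import Literature.NumberTheory.EllipticCurves.TwoDescentKummerBridgeConverse
import Literature.NumberTheory.EllipticCurves.TwoDescentKummerBridgeRealPlace
import Literature.NumberTheory.EllipticCurves.TwoDescentClassOfPair
import Literature.NumberTheory.EllipticCurves.TwoDescentLocalPadic
import Literature.NumberTheory.QuadraticForms.PadicSquareCriteria
import Mathlib.NumberTheory.Padics.HeightOneSpectrum
import HarnessLib

/-!
# Local exhibits for the complete `2`-descent: torsion points, explicit points, and square criteria

The LOWER bound of a complete `2`-descent (Silverman, *AEC*, Prop. X.1.4: "`(b₁, b₂)` is the image of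
a point `P ∈ E(K_v)`") is proved place by place by EXHIBITING a local point whose descent pair is the
candidate `([a], [b])`; by the converse bridge (`TwoDescentKummerBridgeConverse.lean`) this puts the class
with components `([a], [b])` (`twoDescentClass`, `TwoDescentClassOfPair.lean`) in the local Kummer
condition. This file provides the exhibits and the square criteria that feed them:

* §1 square classes: `sqClass x = sqClass y` from `IsSquare (x·y)`; the localised global class
  `[algebraMap a] = sqClass z` from `IsSquare (algebraMap a · z)`;
* §2 **torsion exhibits** over any `K`-field `E` (Silverman X.1.4's values of the descent map at
  `O, T₁, T₂, T₃`: `(1, 1)`, `((e₁−e₂)(e₁−e₃), e₁−e₂)`, `(e₂−e₁, (e₂−e₁)(e₂−e₃))`, `(e₃−e₁, e₃−e₂)`):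
  if `a·c₁(T)` and `b·c₂(T)` are squares in `E` then `([a]_E, [b]_E)` is the descent pair of the
  base-changed `T` (`exists_twoDescentComponent_pair_eq_of_isSquare{,_T₁,_T₂,_T₃}`), and the same for
  an arbitrary `E`-point `(x, y)` (`…_of_nonsingular`);
* §3 **square criteria** (Serre, *Cours d'arithmétique* II §3.3 Thm 3/4, tree `PadicSquareCriteria`):
  in `ℚ_p`, `p ≠ 2`, an element of even valuation whose unit part is a residue square is a square
  (`isSquare_padic_of_even_of_pχ_eq_zero`; on rationals `isSquare_ratCast_padic_of_qrBit_eq_zero`: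
  `v_p(q)` even and `qrBit p q = 0`); in `ℚ₂`, even valuation and unit part `≡ 1 (mod 8)`
  (`isSquare_padic_two_of_even_of_pres8_eq_one`, `isSquare_ratCast_padic_two_of_res8_eq_one`);
  transport to the tree's completions `v.adicCompletion ℚ ≃ ℚ_[ℓ]` (Mathlib `padicEquiv`,
  `isSquare_algebraMap_adicCompletion_of_padic`) and `ℚ_w ≃ ℝ` (`isSquare_algebraMap_completion_of_pos`:
  positive rationals are squares at the real place).

Theorems only; no named fact. Cell `bsd-monsky` (prover-B), towards the `≥` half of Monsky's
`2`-Selmer formula (appendix to Heath-Brown 1994): `#Sel⁽²⁾(E_n/ℚ) = 2^{2+s(n)}`.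

## References

* [SilvermanAEC2009] J. H. Silverman, *The Arithmetic of Elliptic Curves*, 2nd ed., GTM 106,
  Springer 2009, Prop. X.1.4, Example X.1.5, X.§4 (Prop. X.4.9).
* [Serre1973] J.-P. Serre, *A Course in Arithmetic*, GTM 7, Springer 1973, Ch. II §3.3 Thm 3, Thm 4.
-/

noncomputable section

open scoped Classical

universe u

/-! ## §1 Square classes -/

namespace WeierstrassCurve.Affine

/-- Two non-zero elements whose product is a square have the same class in `Fˣ/Fˣ²`.
[cite: SilvermanAEC2009, X.§1 (Example X.1.5)] -/
theorem sqClass_eq_sqClass_of_isSquare_mul {F : Type*} [Field F] {x y : F} (hx : x ≠ 0) (hy : y ≠ 0)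
    (h : IsSquare (x * y)) : sqClass x = sqClass y := by
  obtain ⟨z, hz⟩ := h
  have h1 : sqClass x * sqClass y = 1 := by rw [← sqClass_mul hx hy, hz, sqClass_mul_self]
  rw [SqUnits.eq_mul_of_mul_eq h1, SqUnits.one_mul]

/-- **The localised global class**: for `a ∈ Kˣ` and `z ∈ E` (`E` a `K`-field) with `algebraMap a · z`
a square in `E`, the class of `algebraMap a` in `Eˣ/Eˣ²` is `sqClass z`.
[cite: SilvermanAEC2009, Prop. X.1.4, X.§4 (Prop. X.4.9)] -/
theorem mk_unitsMap_eq_sqClass_of_isSquare {K E : Type*} [Field K] [Field E] [Algebra K E] (a : Kˣ)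
    {z : E} (hz : z ≠ 0) (h : IsSquare (algebraMap K E (a : K) * z)) :
    (QuotientGroup.mk (Units.map (algebraMap K E : K →* E) a) : SqUnits E) = sqClass z := by
  have ha : algebraMap K E (a : K) ≠ 0 := by
    rw [map_ne_zero_iff _ (algebraMap K E).injective]; exact a.ne_zero
  have hmk : (QuotientGroup.mk (Units.map (algebraMap K E : K →* E) a) : SqUnits E) =
      sqClass (algebraMap K E (a : K)) := by
    rw [sqClass_of_ne_zero ha]
    congr 1
    ext
    rw [Units.coe_map, MonoidHom.coe_coe, Units.val_mk0]
  rw [hmk]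
  exact sqClass_eq_sqClass_of_isSquare_mul ha hz h

end WeierstrassCurve.Affine

/-! ## §2 Torsion exhibits and explicit points -/

namespace WeierstrassCurve

open Literature.NumberTheory.GaloisRepresentations Literature.NumberTheory.EllipticCurves Field
open WeierstrassCurve.Affine WeierstrassCurve.Affine.Point

variable {K : Type u} [Field K] [CharZero K] (W : WeierstrassCurve K) [W.IsElliptic] {e₁ e₂ e₃ : K}
variable (E : Type u) [Field E] [Algebra K E] [CharZero E]

omit [CharZero K] [W.IsElliptic] [CharZero E] in
/-- **Exhibit `O`**: if `a` and `b` are squares in `E`, then `([a]_E, [b]_E) = (1, 1)` is the descent pair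
of `O ∈ E(E)`. [cite: SilvermanAEC2009, Prop. X.1.4] -/
theorem exists_twoDescentComponent_pair_eq_of_isSquare (a b : Kˣ)
    (ha : IsSquare (algebraMap K E (a : K))) (hb : IsSquare (algebraMap K E (b : K))) :
    ∃ P : (W.baseChange E).toAffine.Point,
      twoDescentComponent (W.baseChange E).toAffine (algebraMap K E e₁) (algebraMap K E e₂)
          (algebraMap K E e₃) P = QuotientGroup.mk (Units.map (algebraMap K E : K →* E) a) ∧
      twoDescentComponent (W.baseChange E).toAffine (algebraMap K E e₂) (algebraMap K E e₁)
          (algebraMap K E e₃) P = QuotientGroup.mk (Units.map (algebraMap K E : K →* E) b) := by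
  refine ⟨0, ?_, ?_⟩
  · rw [twoDescentComponent_zero, mk_unitsMap_eq_sqClass_of_isSquare a one_ne_zero (by rwa [mul_one]),
      ← mul_one (1 : E), sqClass_mul_self]
  · rw [twoDescentComponent_zero, mk_unitsMap_eq_sqClass_of_isSquare b one_ne_zero (by rwa [mul_one]),
      ← mul_one (1 : E), sqClass_mul_self]

omit [W.IsElliptic] in
/-- **Exhibit `T₁ = (e₁, *)`**: if `a·(e₁−e₂)(e₁−e₃)` and `b·(e₁−e₂)` are squares in `E`, then
`([a]_E, [b]_E)` is the descent pair of `T₁ ∈ E(E)` (Silverman X.1.4: the descent map at `T₁` is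
`((e₁−e₃)/(e₁−e₂), e₁−e₂) ≡ ((e₁−e₂)(e₁−e₃), e₁−e₂)`). [cite: SilvermanAEC2009, Prop. X.1.4] -/
theorem exists_twoDescentComponent_pair_eq_of_isSquare_T₁ (h : W.toAffine.SplitTwoTorsion e₁ e₂ e₃)
    [(W.baseChange E).IsElliptic] (a b : Kˣ)
    (ha : IsSquare (algebraMap K E ((a : K) * ((e₁ - e₂) * (e₁ - e₃)))))
    (hb : IsSquare (algebraMap K E ((b : K) * (e₁ - e₂)))) :
    ∃ P : (W.baseChange E).toAffine.Point,
      twoDescentComponent (W.baseChange E).toAffine (algebraMap K E e₁) (algebraMap K E e₂)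
          (algebraMap K E e₃) P = QuotientGroup.mk (Units.map (algebraMap K E : K →* E) a) ∧
      twoDescentComponent (W.baseChange E).toAffine (algebraMap K E e₂) (algebraMap K E e₁)
          (algebraMap K E e₃) P = QuotientGroup.mk (Units.map (algebraMap K E : K →* E) b) := by
  have hE := h.map E
  refine ⟨Point.some _ _ (nonsingular_twoTorsion hE), ?_, ?_⟩
  · rw [twoDescentComponent_some_of_eq _ rfl,
      mk_unitsMap_eq_sqClass_of_isSquare a hE.c_ne_zero (by simpa only [map_mul, map_sub] using ha)]
  · rw [twoDescentComponent_some_of_ne _ hE.ne₁₂,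
      mk_unitsMap_eq_sqClass_of_isSquare b (sub_ne_zero.mpr hE.ne₁₂)
        (by simpa only [map_mul, map_sub] using hb)]

omit [W.IsElliptic] in
/-- **Exhibit `T₂ = (e₂, *)`**: if `a·(e₂−e₁)` and `b·(e₂−e₁)(e₂−e₃)` are squares in `E`, then
`([a]_E, [b]_E)` is the descent pair of `T₂ ∈ E(E)`. [cite: SilvermanAEC2009, Prop. X.1.4] -/
theorem exists_twoDescentComponent_pair_eq_of_isSquare_T₂ (h : W.toAffine.SplitTwoTorsion e₁ e₂ e₃)
    [(W.baseChange E).IsElliptic] (a b : Kˣ)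
    (ha : IsSquare (algebraMap K E ((a : K) * (e₂ - e₁))))
    (hb : IsSquare (algebraMap K E ((b : K) * ((e₂ - e₁) * (e₂ - e₃))))) :
    ∃ P : (W.baseChange E).toAffine.Point,
      twoDescentComponent (W.baseChange E).toAffine (algebraMap K E e₁) (algebraMap K E e₂)
          (algebraMap K E e₃) P = QuotientGroup.mk (Units.map (algebraMap K E : K →* E) a) ∧
      twoDescentComponent (W.baseChange E).toAffine (algebraMap K E e₂) (algebraMap K E e₁)
          (algebraMap K E e₃) P = QuotientGroup.mk (Units.map (algebraMap K E : K →* E) b) := by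
  have hE := h.swap₁₂.map E
  refine ⟨Point.some _ _ (nonsingular_twoTorsion hE), ?_, ?_⟩
  · rw [twoDescentComponent_some_of_ne _ hE.ne₁₂,
      mk_unitsMap_eq_sqClass_of_isSquare a (sub_ne_zero.mpr hE.ne₁₂)
        (by simpa only [map_mul, map_sub] using ha)]
  · rw [twoDescentComponent_some_of_eq _ rfl,
      mk_unitsMap_eq_sqClass_of_isSquare b hE.c_ne_zero (by simpa only [map_mul, map_sub] using hb)]

omit [W.IsElliptic] in
/-- **Exhibit `T₃ = (e₃, *)`**: if `a·(e₃−e₁)` and `b·(e₃−e₂)` are squares in `E`, then `([a]_E, [b]_E)`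
is the descent pair of `T₃ ∈ E(E)`. [cite: SilvermanAEC2009, Prop. X.1.4] -/
theorem exists_twoDescentComponent_pair_eq_of_isSquare_T₃ (h : W.toAffine.SplitTwoTorsion e₁ e₂ e₃)
    [(W.baseChange E).IsElliptic] (a b : Kˣ)
    (ha : IsSquare (algebraMap K E ((a : K) * (e₃ - e₁))))
    (hb : IsSquare (algebraMap K E ((b : K) * (e₃ - e₂)))) :
    ∃ P : (W.baseChange E).toAffine.Point,
      twoDescentComponent (W.baseChange E).toAffine (algebraMap K E e₁) (algebraMap K E e₂)
          (algebraMap K E e₃) P = QuotientGroup.mk (Units.map (algebraMap K E : K →* E) a) ∧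
      twoDescentComponent (W.baseChange E).toAffine (algebraMap K E e₂) (algebraMap K E e₁)
          (algebraMap K E e₃) P = QuotientGroup.mk (Units.map (algebraMap K E : K →* E) b) := by
  have hE := h.swap₂₃.swap₁₂.map E
  refine ⟨Point.some _ _ (nonsingular_twoTorsion hE), ?_, ?_⟩
  · rw [twoDescentComponent_some_of_ne _ hE.ne₁₂,
      mk_unitsMap_eq_sqClass_of_isSquare a (sub_ne_zero.mpr hE.ne₁₂)
        (by simpa only [map_mul, map_sub] using ha)]
  · rw [twoDescentComponent_some_of_ne _ hE.ne₁₃,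
      mk_unitsMap_eq_sqClass_of_isSquare b (sub_ne_zero.mpr hE.ne₁₃)
        (by simpa only [map_mul, map_sub] using hb)]

omit [CharZero K] [W.IsElliptic] [CharZero E] in
/-- **Exhibit an arbitrary local point `(x, y) ∈ E(E)`** with `x ≠ e₁, e₂`: if `a·(x − e₁)` and `b·(x − e₂)`
are squares in `E`, then `([a]_E, [b]_E)` is its descent pair. [cite: SilvermanAEC2009, Prop. X.1.4] -/
theorem exists_twoDescentComponent_pair_eq_of_nonsingular (a b : Kˣ) {x y : E}
    (hxy : (W.baseChange E).toAffine.Nonsingular x y) (hx₁ : x ≠ algebraMap K E e₁)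
    (hx₂ : x ≠ algebraMap K E e₂) (ha : IsSquare (algebraMap K E (a : K) * (x - algebraMap K E e₁)))
    (hb : IsSquare (algebraMap K E (b : K) * (x - algebraMap K E e₂))) :
    ∃ P : (W.baseChange E).toAffine.Point,
      twoDescentComponent (W.baseChange E).toAffine (algebraMap K E e₁) (algebraMap K E e₂)
          (algebraMap K E e₃) P = QuotientGroup.mk (Units.map (algebraMap K E : K →* E) a) ∧
      twoDescentComponent (W.baseChange E).toAffine (algebraMap K E e₂) (algebraMap K E e₁)
          (algebraMap K E e₃) P = QuotientGroup.mk (Units.map (algebraMap K E : K →* E) b) :=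
  ⟨Point.some _ _ hxy,
    by rw [twoDescentComponent_some_of_ne _ hx₁, mk_unitsMap_eq_sqClass_of_isSquare a (sub_ne_zero.mpr hx₁) ha],
    by rw [twoDescentComponent_some_of_ne _ hx₂, mk_unitsMap_eq_sqClass_of_isSquare b (sub_ne_zero.mpr hx₂) hb]⟩

end WeierstrassCurve

/-! ## §3 Square criteria in `ℚ_p`, `ℚ₂`, the completions of `ℚ`, and `ℝ` -/

namespace Literature.NumberTheory.EllipticCurves.TwoDescentLocal

open Literature.NumberTheory.QuadraticForms

section Padic

variable (p : ℕ) [hp : Fact p.Prime]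

/-- **Serre's Theorem 3 as a square test in `ℚ_p`, `p ≠ 2`**: a non-zero `t ∈ ℚ_p` of even valuation
whose unit part is a square modulo `p` (`pχ p t = 0`) is a square. [cite: Serre1973, Ch. II §3.3 Thm 3] -/
theorem isSquare_padic_of_even_of_pχ_eq_zero (hp2 : p ≠ 2) {t : ℚ_[p]} (ht : t ≠ 0)
    (hev : Even t.valuation) (hχ : pχ p t = 0) : IsSquare t := by
  obtain ⟨u, hu⟩ := isUnit_punitInt p ht
  have hsq : IsSquare (PadicInt.toZMod (u : ℤ_[p])) := by
    rw [hu]; exact (pχ_eq_zero_iff p t).mp hχ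
  have key := (padic_isSquare_zpow_mul_unit_iff_odd hp2 u t.valuation).mpr ⟨hev, hsq⟩
  have hut : ((u : ℤ_[p]) : ℚ_[p]) = punit p t := by rw [hu]; rfl
  rwa [hut, zpow_mul_punit] at key

/-- **On rationals** (`p ≠ 2`): `q ≠ 0` with `v_p(q)` even and `qrBit p q = 0` (the `p`-unit part of `q`
is a quadratic residue) is a square in `ℚ_p`. [cite: Serre1973, Ch. II §3.3 Thm 3] -/
theorem isSquare_ratCast_padic_of_qrBit_eq_zero (hp2 : p ≠ 2) {q : ℚ} (hq : q ≠ 0)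
    (hev : Even (padicValRat p q)) (hχ : qrBit p q = 0) : IsSquare ((q : ℚ) : ℚ_[p]) := by
  refine isSquare_padic_of_even_of_pχ_eq_zero p hp2 (by exact_mod_cast hq) ?_ (by rwa [pχ_ratCast])
  rwa [Padic.valuation_ratCast]

/-- **Serre's Theorem 4 as a square test in `ℚ₂`**: a non-zero `t ∈ ℚ₂` of even valuation whose unit
part is `≡ 1 (mod 8)` is a square. [cite: Serre1973, Ch. II §3.3 Thm 4] -/
theorem isSquare_padic_two_of_even_of_pres8_eq_one {t : ℚ_[2]} (ht : t ≠ 0) (hev : Even t.valuation)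
    (h8 : pres8 t = 1) : IsSquare t := by
  obtain ⟨u, hu⟩ := isUnit_punitInt 2 ht
  have h1 : PadicInt.toZModPow 3 (u : ℤ_[2]) = 1 := by rw [hu]; exact h8
  have key := (padic_two_isSquare_zpow_mul_unit_iff u t.valuation).mpr ⟨hev, h1⟩
  have hut : ((u : ℤ_[2]) : ℚ_[2]) = punit 2 t := by rw [hu]; rfl
  have h2 := zpow_mul_punit 2 t
  rw [Nat.cast_ofNat] at h2
  rwa [hut, h2] at key

/-- **On rationals** (`p = 2`): `q ≠ 0` with `v₂(q)` even and odd part `≡ 1 (mod 8)` (`res8 q = 1`) is a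
square in `ℚ₂`. [cite: Serre1973, Ch. II §3.3 Thm 4] -/
theorem isSquare_ratCast_padic_two_of_res8_eq_one {q : ℚ} (hq : q ≠ 0) (hev : Even (padicValRat 2 q))
    (h8 : res8 q = 1) : IsSquare ((q : ℚ) : ℚ_[2]) := by
  refine isSquare_padic_two_of_even_of_pres8_eq_one (by exact_mod_cast hq) ?_ (by rwa [pres8_ratCast])
  rwa [Padic.valuation_ratCast]

end Padic

/-! ### Transport to the completions of `ℚ` -/

open IsDedekindDomain NumberField Rat.HeightOneSpectrum

/-- **From `ℚ_ℓ` to the tree's completion `v.adicCompletion ℚ`** (`ℓ = primesEquiv v`, Mathlib's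
`ℚ`-algebra isomorphism `padicEquiv`): a rational that is a square in `ℚ_ℓ` is a square in `ℚ_v`.
[cite: SilvermanAEC2009, X.§1 (Example X.1.5)] -/
theorem isSquare_algebraMap_adicCompletion_of_padic (v : HeightOneSpectrum (𝓞 ℚ)) {q : ℚ}
    (h : haveI := WeierstrassCurve.fact_prime_primesEquiv v; IsSquare ((q : ℚ) : ℚ_[(primesEquiv v : ℕ)])) :
    IsSquare (algebraMap ℚ (v.adicCompletion ℚ) q) := by
  haveI := WeierstrassCurve.fact_prime_primesEquiv v
  obtain ⟨z, hz⟩ := h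
  refine ⟨(adicCompletion.padicEquiv v).symm z, ?_⟩
  rw [← map_mul, ← hz]
  have h1 : (adicCompletion.padicEquiv v).symm ((q : ℚ) : ℚ_[(primesEquiv v : ℕ)]) =
      (adicCompletion.padicEquiv v).symm (algebraMap ℚ ℚ_[(primesEquiv v : ℕ)] q) := by
    rw [eq_ratCast]
  rw [h1]
  exact ((adicCompletion.padicEquiv v).symm.toAlgEquiv.commutes q).symm

/-- **Positive rationals are squares at the real place**: for an infinite place `w` of `ℚ` (necessarily
real, `ℚ_w ≃ ℝ`) and `q > 0`, `algebraMap ℚ ℚ_w q` is a square. [cite: SilvermanAEC2009, Prop. X.1.4] -/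
theorem isSquare_algebraMap_completion_of_pos (w : InfinitePlace ℚ) {q : ℚ} (hq : 0 < q) :
    IsSquare (algebraMap ℚ w.Completion q) := by
  have hw : w.IsReal := (Subsingleton.elim Rat.infinitePlace w) ▸ Rat.isReal_infinitePlace
  set φ := InfinitePlace.Completion.ringEquivRealOfIsReal hw with hφ
  have hφq : φ (algebraMap ℚ w.Completion q) = (q : ℝ) := WeierstrassCurve.ringEquivRealOfIsReal_algebraMap w hw q
  have hq0 : (0 : ℝ) ≤ (q : ℝ) := le_of_lt (by exact_mod_cast hq)
  refine ⟨φ.symm (Real.sqrt q), ?_⟩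
  apply φ.injective
  rw [map_mul, RingEquiv.apply_symm_apply, hφq]
  exact (Real.mul_self_sqrt hq0).symm

end Literature.NumberTheory.EllipticCurves.TwoDescentLocal

end
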